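import Mathlib
import Summits.KontsevichZagierPeriods.Zeta5Search.FourthOrderFrame
import Summits.KontsevichZagierPeriods.Zeta5Search.SecondResidueLaw
import Summits.KontsevichZagierPeriods.Zeta5Search.SecondOrderCentre
import Summits.KontsevichZagierPeriods.Zeta5Search.ClassFunctionPFIdentity
import HarnessLib

/-!
# ζ(5) search — the fourth-order digit BRACKETS as polynomial frame functionals of the own type (tools for THEOREM L5)

Cell `pub-zeta5` (HONEST FRAMING: systematic search; no irrationality claim unless certified), typer seat generation 13.
The classwise fourth digits (`SecondResidueLaw.FourthDigitW/V`, gen-2 g13) express `W_x`, `V_x` through the brackets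
`ŵ − pφŵ₂ + p²cŵ₃ − p³c₃ŵ₄` and `v̂ − pφv̂₂ + p²cv̂₃ − p³c₃v̂₄` of CLASS functionals.  For a level class `x < p` (levels `0..L`,
exponents `e_k = netExp(x + kp)`, odd centre allowed) this file identifies them with the polynomial frame functionals of
`FourthOrderFrame` on the class's OWN type:
* `centreZ` — the centre factor `Z = X − L/2` (odd `b₀`, centre in the class; then `b₀ = 2x + Lp`) or `1`;
  `classCofactor_levelZ`: `classCofactor(x + ip) = G^T_i(ε) · Z(i + ε)`; `classRho_levelZ`, `rhoK_levelZ` (`ρ^{(k)}_{q,σ} = ρ[η^k Z Φ_T]_{i,σ}`);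
* `frameRho_X_pow_mul` — `ρ[η^n G Φ_T]_{i,σ} = Σ_m C(n,m) i^{n−m} ρ[GΦ_T]_{i,σ+m}`;
* the level lemmas `wHat_levelZ … wHat4_levelZ`, `vHat_levelZ … vHat4_levelZ`: `ŵ_{n+1,x} = ŵ[η^n Z Φ_T]`, `v̂_{n+1,x} = v̂[η^n Z Φ_T]`;
* `bracketW_eq`, `bracketV_eq`: the two brackets are `ŵ[Q_x Z Φ_T]`, `v̂[Q_x Z Φ_T]` with the CUBIC `Q_x = fourthQ`,
  `Q_x(η) = 1 − pφ_x η + p²c_x η² − p³c₃,x η³`.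
Power-series bookkeeping over `ℚ`; nothing here bears on irrationality.
-/

noncomputable section

open Finset PowerSeries

namespace Summit.KontsevichZagierPeriods.Zeta5Search.SecondOrder

open Summit.KontsevichZagierPeriods.Zeta5Search.ClusterValuation
open Summit.KontsevichZagierPeriods.Zeta5Search.PadicSeries
open Summit.KontsevichZagierPeriods.Zeta5Search.CasoratianValuation (InPolytope)
open Summit.KontsevichZagierPeriods.Zeta5Search.LevelClass (typeRho typeW typeV classSet_level level_injective level_mem
  classPoles_level)
open Summit.KontsevichZagierPeriods.Zeta5Search.SecondResidueLaw (phi3Hat cubicHat wHat4 vHat4)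
open Literature.NumberTheory.Transcendental.BallRivoal (harm)

variable {p : ℕ} [hp : Fact p.Prime]

/-! ## §1 The generalized monomial formula -/

omit hp in
/-- **`ρ[η^n G Φ_T]_{i,σ} = Σ_{m=0}^{n} C(n,m) i^{n−m} ρ[GΦ_T]_{i,σ+m}`** (terms with `σ + m > n_i` absent). -/
theorem frameRho_X_pow_mul (L : ℕ) (e : ℕ → ℤ) (n : ℕ) (G : Polynomial ℚ) (i σ : ℕ) :
    frameRho L e (Polynomial.X ^ n * G) i σ =
      ∑ m ∈ range (n + 1), if (σ : ℤ) + m ≤ -e i then (n.choose m : ℚ) * (i : ℚ) ^ (n - m) * frameRho L e G i (σ + m) else 0 := by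
  unfold frameRho
  by_cases hσ : (σ : ℤ) ≤ -e i
  · rw [if_pos hσ, polyAtLevel_mul, polyAtLevel_X_pow, mul_assoc, coeff_linPow_mul]
    refine sum_congr rfl fun m _ => ?_
    by_cases hm : (σ : ℤ) + m ≤ -e i
    · rw [if_pos (by omega), if_pos hm, if_pos (by push_cast; exact hm),
        show (-e i).toNat - σ - m = (-e i).toNat - (σ + m) by omega]
    · rw [if_neg (by omega), if_neg hm]
  · rw [if_neg hσ]
    exact (sum_eq_zero fun m _ => by rw [if_neg (by omega)]).symm

/-! ## §2 The centre factor and the cofactor of a level class -/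

/-- The CENTRE FACTOR of a level class with base `x` and top level `L`: `X − L/2` if `b₀` is odd and the centre lies in the class
(the centre then sits at the half-integer level `L/2`), `1` otherwise. -/
def centreZ (b : ℕ → ℤ) (p x L : ℕ) : Polynomial ℚ :=
  if ¬ (2 : ℤ) ∣ b 0 ∧ CentreIn b p x then Polynomial.X - Polynomial.C ((L : ℚ) / 2) else 1

/-- The CUBIC Taylor polynomial of the foreign factor at the base `x`: `Q_x(η) = 1 − pφ_x η + p²c_x η² − p³c₃,x η³`. -/
def fourthQ (b : ℕ → ℤ) (p x : ℕ) : Polynomial ℚ :=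
  1 - Polynomial.C ((p : ℚ) * phiHat b p x) * Polynomial.X + Polynomial.C ((p : ℚ) ^ 2 * curvHat b p x) * Polynomial.X ^ 2
    - Polynomial.C ((p : ℚ) ^ 3 * cubicHat b p x) * Polynomial.X ^ 3

omit hp in
/-- Expanding an additive, `ℚ`-homogeneous functional along `Q_x`. -/
theorem framePoly_fourthQ_mul (b : ℕ → ℤ) (p x : ℕ) (F : Polynomial ℚ → ℚ) (hadd : ∀ G H, F (G + H) = F G + F H)
    (hsub : ∀ G H, F (G - H) = F G - F H) (hC : ∀ (c : ℚ) G, F (Polynomial.C c * G) = c * F G) (Z : Polynomial ℚ) :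
    F (fourthQ b p x * Z) = F Z - (p : ℚ) * phiHat b p x * F (Polynomial.X * Z)
      + (p : ℚ) ^ 2 * curvHat b p x * F (Polynomial.X ^ 2 * Z) - (p : ℚ) ^ 3 * cubicHat b p x * F (Polynomial.X ^ 3 * Z) := by
  have e : fourthQ b p x * Z = Z - Polynomial.C ((p : ℚ) * phiHat b p x) * (Polynomial.X * Z)
      + Polynomial.C ((p : ℚ) ^ 2 * curvHat b p x) * (Polynomial.X ^ 2 * Z)
      - Polynomial.C ((p : ℚ) ^ 3 * cubicHat b p x) * (Polynomial.X ^ 3 * Z) := by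
    unfold fourthQ; ring
  rw [e, hsub, hadd, hsub, hC, hC, hC]

section Level

variable (b : ℕ → ℤ) (hb : InPolytope b) {x L : ℕ} (hx : x < p) (hL : x + L * p ≤ (b 0).toNat)
  (hL' : (b 0).toNat < x + L * p + p) (e : ℕ → ℤ) (he : ∀ k ≤ L, netExp b (x + k * p) = e k)
include hb hx hL hL' he

omit he in
/-- **The cofactor at the `i`-th point is `G^T_i(ε) · Z(i + ε)`.** -/
theorem classCofactor_levelZ {i : ℕ} (hi : i ≤ L) :
    classCofactor b p (x + i * p) = typeProd L (fun k => netExp b (x + k * p)) i * polyAtLevel (centreZ b p x L) i := by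
  have h0 : 0 ≤ b 0 := hb.1.1
  have hq := level_mem b hx hL hL' hi
  have hp0 : (p : ℚ) ≠ 0 := Nat.cast_ne_zero.2 hp.out.ne_zero
  have hprod : (∏ s ∈ (classSet b p (x + i * p)).erase (x + i * p), binomSeries ((((x + i * p : ℕ) : ℚ) - s) / p) (netExp b s)) =
      typeProd L (fun k => netExp b (x + k * p)) i := by
    unfold typeProd
    rw [classSet_eq_of_mem hq, classSet_level b hx hL hL', ← image_erase (level_injective hp.out.pos x),
      prod_image (fun a _ c _ h => level_injective hp.out.pos x h)]
    refine prod_congr rfl fun j _ => ?_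
    congr 1
    rw [div_eq_iff hp0]; push_cast; ring
  unfold classCofactor centreZ
  rw [hprod]
  by_cases hc : ¬ (2 : ℤ) ∣ b 0 ∧ CentreIn b p x
  · have hcenq : CentreIn b p (x + i * p) := (centreIn_iff_of_mem hq).2 hc.2
    have hctr := centre_level_eq b hx hL hL' hc.2 h0
    have hδ : (((x + i * p : ℕ) : ℚ) - ((b 0 : ℤ) : ℚ) / 2) / p = ((i : ℕ) : ℚ) - (L : ℚ) / 2 := by
      have : ((b 0 : ℤ) : ℚ) = 2 * x + L * p := by exact_mod_cast hctr
      rw [this, div_eq_iff hp0]; push_cast; ring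
    have hδ0 : (((i : ℕ) : ℚ) - (L : ℚ) / 2) ≠ 0 := by
      intro h
      apply odd_L_of_centre b hx hL hL' hc.1 hc.2 h0
      exact ⟨i, by exact_mod_cast (show (L : ℚ) = 2 * i by linarith)⟩
    rw [if_pos ⟨hc.1, hcenq⟩, if_pos hc, hδ, binomSeries_one hδ0]
    unfold polyAtLevel
    rw [Polynomial.sub_comp, Polynomial.X_comp, Polynomial.C_comp, add_sub_assoc, ← Polynomial.C_sub, Polynomial.coe_add,
      Polynomial.coe_X, Polynomial.coe_C]
  · rw [if_neg (fun h => hc ⟨h.1, (centreIn_iff_of_mem hq).1 h.2⟩), if_neg hc, polyAtLevel_one]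

/-- **`ρ_{x+ip,σ} = ρ[Z Φ_T]_{i,σ}`** (`σ ≤ n_i`). -/
theorem classRho_levelZ {i : ℕ} (hi : i ≤ L) {σ : ℕ} (hσ : (σ : ℤ) ≤ -e i) :
    classRho b p (x + i * p) σ = frameRho L e (centreZ b p x L) i σ := by
  unfold classRho frameRho
  rw [if_pos hσ, he i hi, classCofactor_levelZ b hb hx hL hL' hi, mul_comm, typeProd_congr_off (e' := e) fun j hj _ => he j hj]

/-- **`ρ^{(k)}_{x+ip,σ} = ρ[η^k Z Φ_T]_{i,σ}`** (`σ ≤ n_i`). -/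
theorem rhoK_levelZ {i : ℕ} (hi : i ≤ L) (k : ℕ) {σ : ℕ} (hσ : (σ : ℤ) ≤ -e i) :
    rhoK b p (x + i * p) k σ = frameRho L e (Polynomial.X ^ k * centreZ b p x L) i σ := by
  unfold rhoK frameRho
  rw [if_pos hσ, he i hi, classCofactor_levelZ b hb hx hL hL' hi, lvl, level_div hx, polyAtLevel_mul, polyAtLevel_X_pow,
    typeProd_congr_off (e' := e) fun j hj _ => he j hj]
  ring_nf

/-! ### The eight level lemmas

Scheme: reindex the class poles by levels, expand `ρ[η^n Z Φ_T]` by `frameRho_X_pow_mul`, turn every guarded `ρ_{q,σ}` into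
`ρ[ZΦ_T]_{k,σ}` (contextual rewriting under its guard), normalise the binomial bookkeeping, and compare the guards. -/

/-- **`ŵ_x = ŵ[Z Φ_T]`.** -/
theorem wHat_levelZ : wHat b p x = frameWPoly L e (centreZ b p x L) := by
  have hP : (classSet b p x).filter (fun q => netExp b q < 0) =
      ((range (L + 1)).filter fun k => e k < 0).image fun k => x + k * p := classPoles_level b hx hL hL' e he
  unfold wHat frameWPoly classPoles
  rw [hP, sum_image (fun a _ c _ h => level_injective hp.out.pos x h)]
  refine sum_congr rfl fun k hk => ?_
  have hkL : k ≤ L := by have := mem_range.1 (mem_filter.1 hk).1; omega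
  rw [he k hkL, ← one_mul (centreZ b p x L), ← pow_zero Polynomial.X, frameRho_X_pow_mul, sum_range_one]
  simp +contextual (disch := omega) only [classRho_levelZ b hb hx hL hL' e he hkL]
  simp only [Nat.choose_self, Nat.cast_one,
    Nat.cast_ofNat, Nat.cast_zero, Nat.sub_self, pow_zero,
    one_mul, mul_one, add_zero]
  split_ifs <;> first | omega | rfl

/-- **`ŵ₂,x = ŵ[η Z Φ_T]`.** -/
theorem wHat2_levelZ : wHat2 b p x = frameWPoly L e (Polynomial.X * centreZ b p x L) := by
  have hP : (classSet b p x).filter (fun q => netExp b q < 0) =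
      ((range (L + 1)).filter fun k => e k < 0).image fun k => x + k * p := classPoles_level b hx hL hL' e he
  unfold wHat2 frameWPoly classPoles
  rw [hP, sum_image (fun a _ c _ h => level_injective hp.out.pos x h)]
  refine sum_congr rfl fun k hk => ?_
  have hkL : k ≤ L := by have := mem_range.1 (mem_filter.1 hk).1; omega
  rw [he k hkL, level_div hx, ← pow_one Polynomial.X, frameRho_X_pow_mul, sum_range_succ, sum_range_one]
  simp +contextual (disch := omega) only [classRho_levelZ b hb hx hL hL' e he hkL]
  simp only [Nat.choose_zero_right, Nat.choose_self, Nat.cast_one,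
    Nat.cast_ofNat, Nat.cast_zero, Nat.sub_zero, Nat.sub_self, Nat.reduceAdd, Int.reduceAdd, pow_zero, pow_one,
    one_mul, mul_one, add_zero]
  split_ifs <;> first | omega | rfl

/-- **`ŵ₃,x = ŵ[η² Z Φ_T]`.** -/
theorem wHat3_levelZ : wHat3 b p x = frameWPoly L e (Polynomial.X ^ 2 * centreZ b p x L) := by
  have hP : (classSet b p x).filter (fun q => netExp b q < 0) =
      ((range (L + 1)).filter fun k => e k < 0).image fun k => x + k * p := classPoles_level b hx hL hL' e he
  unfold wHat3 frameWPoly classPoles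
  rw [hP, sum_image (fun a _ c _ h => level_injective hp.out.pos x h)]
  refine sum_congr rfl fun k hk => ?_
  have hkL : k ≤ L := by have := mem_range.1 (mem_filter.1 hk).1; omega
  rw [he k hkL, level_div hx, frameRho_X_pow_mul, sum_range_succ, sum_range_succ, sum_range_one]
  simp +contextual (disch := omega) only [classRho_levelZ b hb hx hL hL' e he hkL]
  simp only [Nat.choose_zero_right, Nat.choose_self, show Nat.choose 2 1 = 2 from rfl, Nat.cast_one,
    Nat.cast_ofNat, Nat.cast_zero, Nat.sub_zero, Nat.sub_self, Nat.reduceSub, Nat.reduceAdd, Int.reduceAdd, pow_zero, pow_one,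
    one_mul, mul_one, add_zero]
  split_ifs <;> first | omega | rfl

/-- **`ŵ₄,x = ŵ[η³ Z Φ_T]`.** -/
theorem wHat4_levelZ : wHat4 b p x = frameWPoly L e (Polynomial.X ^ 3 * centreZ b p x L) := by
  have hP : (classSet b p x).filter (fun q => netExp b q < 0) =
      ((range (L + 1)).filter fun k => e k < 0).image fun k => x + k * p := classPoles_level b hx hL hL' e he
  unfold wHat4 frameWPoly classPoles
  rw [hP, sum_image (fun a _ c _ h => level_injective hp.out.pos x h)]
  refine sum_congr rfl fun k hk => ?_
  have hkL : k ≤ L := by have := mem_range.1 (mem_filter.1 hk).1; omega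
  rw [he k hkL, level_div hx, frameRho_X_pow_mul, sum_range_succ, sum_range_succ, sum_range_succ, sum_range_one]
  simp +contextual (disch := omega) only [classRho_levelZ b hb hx hL hL' e he hkL]
  simp only [Nat.choose_zero_right, Nat.choose_self, show Nat.choose 3 1 = 3 from rfl, show Nat.choose 3 2 = 3 from rfl, Nat.cast_one,
    Nat.cast_ofNat, Nat.cast_zero, Nat.sub_zero, Nat.sub_self, Nat.reduceSub, Nat.reduceAdd, Int.reduceAdd, pow_zero, pow_one,
    one_mul, mul_one, add_zero]
  split_ifs <;> first | omega | rfl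

/-- **`v̂_x = v̂[Z Φ_T]`.** -/
theorem vHat_levelZ : vHat b p x = frameVPoly L e (centreZ b p x L) := by
  have hP : (classSet b p x).filter (fun q => netExp b q < 0) =
      ((range (L + 1)).filter fun k => e k < 0).image fun k => x + k * p := classPoles_level b hx hL hL' e he
  unfold vHat frameVPoly classPoles
  rw [hP, sum_image (fun a _ c _ h => level_injective hp.out.pos x h)]
  refine sum_congr rfl fun k hk => ?_
  have hkL : k ≤ L := by have := mem_range.1 (mem_filter.1 hk).1; omega
  have hneg := (mem_filter.1 hk).2
  rw [he k hkL, level_div hx]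
  refine sum_congr rfl fun σ hσ => ?_
  have hσ' := mem_Icc.1 hσ
  rw [classRho_levelZ b hb hx hL hL' e he hkL (by omega)]

/-- **`v̂₂,x = v̂[η Z Φ_T]`.** -/
theorem vHat2_levelZ : vHat2 b p x = frameVPoly L e (Polynomial.X * centreZ b p x L) := by
  have hP : (classSet b p x).filter (fun q => netExp b q < 0) =
      ((range (L + 1)).filter fun k => e k < 0).image fun k => x + k * p := classPoles_level b hx hL hL' e he
  unfold vHat2 frameVPoly classPoles
  rw [hP, sum_image (fun a _ c _ h => level_injective hp.out.pos x h)]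
  refine sum_congr rfl fun k hk => ?_
  have hkL : k ≤ L := by have := mem_range.1 (mem_filter.1 hk).1; omega
  have hneg := (mem_filter.1 hk).2
  rw [he k hkL, level_div hx]
  refine sum_congr rfl fun σ hσ => ?_
  have hσ' := mem_Icc.1 hσ
  rw [← pow_one Polynomial.X, frameRho_X_pow_mul, sum_range_succ, sum_range_one]
  simp +contextual (disch := omega) only [classRho_levelZ b hb hx hL hL' e he hkL]
  simp only [Nat.choose_zero_right, Nat.choose_self, Nat.cast_one,
    Nat.cast_zero, Nat.sub_zero, Nat.sub_self, pow_zero, pow_one,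
    one_mul, mul_one, add_zero]
  split_ifs <;> first | omega | rfl

/-- **`v̂₃,x = v̂[η² Z Φ_T]`.** -/
theorem vHat3_levelZ : vHat3 b p x = frameVPoly L e (Polynomial.X ^ 2 * centreZ b p x L) := by
  have hP : (classSet b p x).filter (fun q => netExp b q < 0) =
      ((range (L + 1)).filter fun k => e k < 0).image fun k => x + k * p := classPoles_level b hx hL hL' e he
  unfold vHat3 frameVPoly classPoles
  rw [hP, sum_image (fun a _ c _ h => level_injective hp.out.pos x h)]
  refine sum_congr rfl fun k hk => ?_
  have hkL : k ≤ L := by have := mem_range.1 (mem_filter.1 hk).1; omega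
  have hneg := (mem_filter.1 hk).2
  rw [he k hkL, level_div hx]
  refine sum_congr rfl fun σ hσ => ?_
  have hσ' := mem_Icc.1 hσ
  rw [frameRho_X_pow_mul, sum_range_succ, sum_range_succ, sum_range_one]
  simp +contextual (disch := omega) only [classRho_levelZ b hb hx hL hL' e he hkL]
  simp only [Nat.choose_zero_right, Nat.choose_self, show Nat.choose 2 1 = 2 from rfl, Nat.cast_one,
    Nat.cast_ofNat, Nat.cast_zero, Nat.sub_zero, Nat.sub_self, Nat.reduceSub, pow_zero, pow_one,
    one_mul, mul_one, add_zero]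
  split_ifs <;> first | omega | rfl

/-- **`v̂₄,x = v̂[η³ Z Φ_T]`.** -/
theorem vHat4_levelZ : vHat4 b p x = frameVPoly L e (Polynomial.X ^ 3 * centreZ b p x L) := by
  have hP : (classSet b p x).filter (fun q => netExp b q < 0) =
      ((range (L + 1)).filter fun k => e k < 0).image fun k => x + k * p := classPoles_level b hx hL hL' e he
  unfold vHat4 frameVPoly classPoles
  rw [hP, sum_image (fun a _ c _ h => level_injective hp.out.pos x h)]
  refine sum_congr rfl fun k hk => ?_
  have hkL : k ≤ L := by have := mem_range.1 (mem_filter.1 hk).1; omega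
  have hneg := (mem_filter.1 hk).2
  rw [he k hkL, level_div hx]
  refine sum_congr rfl fun σ hσ => ?_
  have hσ' := mem_Icc.1 hσ
  rw [frameRho_X_pow_mul, sum_range_succ, sum_range_succ, sum_range_succ, sum_range_one]
  simp +contextual (disch := omega) only [classRho_levelZ b hb hx hL hL' e he hkL]
  simp only [Nat.choose_zero_right, Nat.choose_self, show Nat.choose 3 1 = 3 from rfl, show Nat.choose 3 2 = 3 from rfl, Nat.cast_one,
    Nat.cast_ofNat, Nat.cast_zero, Nat.sub_zero, Nat.sub_self, Nat.reduceSub, pow_zero, pow_one,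
    one_mul, mul_one, add_zero]
  split_ifs <;> first | omega | rfl

/-! ## §3 The brackets -/

/-- **The `W`-bracket is `ŵ[Q_x Z Φ_T]`.** -/
theorem bracketW_eq :
    wHat b p x - (p : ℚ) * phiHat b p x * wHat2 b p x + (p : ℚ) ^ 2 * curvHat b p x * wHat3 b p x
        - (p : ℚ) ^ 3 * cubicHat b p x * wHat4 b p x = frameWPoly L e (fourthQ b p x * centreZ b p x L) := by
  rw [framePoly_fourthQ_mul b p x (frameWPoly L e) (frameWPoly_add L e) (frameWPoly_sub L e) (frameWPoly_C_mul L e),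
    wHat_levelZ b hb hx hL hL' e he, wHat2_levelZ b hb hx hL hL' e he, wHat3_levelZ b hb hx hL hL' e he,
    wHat4_levelZ b hb hx hL hL' e he]

/-- **The `V`-bracket is `v̂[Q_x Z Φ_T]`.** -/
theorem bracketV_eq :
    vHat b p x - (p : ℚ) * phiHat b p x * vHat2 b p x + (p : ℚ) ^ 2 * curvHat b p x * vHat3 b p x
        - (p : ℚ) ^ 3 * cubicHat b p x * vHat4 b p x = frameVPoly L e (fourthQ b p x * centreZ b p x L) := by
  rw [framePoly_fourthQ_mul b p x (frameVPoly L e) (frameVPoly_add L e) (frameVPoly_sub L e) (frameVPoly_C_mul L e),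
    vHat_levelZ b hb hx hL hL' e he, vHat2_levelZ b hb hx hL hL' e he, vHat3_levelZ b hb hx hL hL' e he,
    vHat4_levelZ b hb hx hL hL' e he]

end Level

end Summit.KontsevichZagierPeriods.Zeta5Search.SecondOrder

end
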